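import Summits.QuantumAdvantage.QuantumAdvantage.Theses.OddPrimeWalk
import Summits.QuantumAdvantage.AdviceFreeQNC0.OddPrimeLadder

/-!
# Route OddPrimeWalk — support `BridgeOdd` (item stmt-QuantumAdvantage-22730) closes from the tree

`BridgeOdd := ∀ p prime, 5 ≤ p → WalkHardF p → AdviceFreeQNC0Sep p` is the landed odd-prime ladder
`Summit.QuantumAdvantage.AdviceFreeQNC0.adviceFreeQNC0Sep_of_walkHardF` (`OddPrimeLadder.lean`, seat qn-prover-3,
p564188; transport `WalkHardF p → RingHardOdd p → RingHard p` and the landed bridge to the separation), which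
holds for every prime; the hypothesis `5 ≤ p` is not used.  Seat qa-qnc0-prover gen 10.
-/

set_option linter.dupNamespace false

namespace Summit.QuantumAdvantage.QuantumAdvantage.Theorems

/-- Item stmt-QuantumAdvantage-22730 `BridgeOdd` of route OddPrimeWalk: `WalkHardF p → AdviceFreeQNC0Sep p`
for every prime `p ≥ 5` — by `AdviceFreeQNC0.adviceFreeQNC0Sep_of_walkHardF`. -/
theorem bridgeOdd_proof : Summit.QuantumAdvantage.QuantumAdvantage.Theses.OddPrimeWalk.BridgeOdd :=
  fun p _ _ h => Summit.QuantumAdvantage.AdviceFreeQNC0.adviceFreeQNC0Sep_of_walkHardF p h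

end Summit.QuantumAdvantage.QuantumAdvantage.Theorems
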